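import Summits.ResolutionOfSingularities.ResolutionOfSingularities.Theorems.PurelyInseparableDim4ResConeSatelliteLight
import Summits.ResolutionOfSingularities.ResolutionOfSingularities.Theorems.PurelyInseparableDim4ResConeStretchLedger
import HarnessLib
import HarnessLib.Audit.Tags

/-!
# Purely inseparable four-folds — SLICE B, THE LOCATED LIGHT RESIDUAL: along every slice-B stretch satellite
# steps with `oₖ + oₖ₊₁ + 3 ≤ 3p` occur beyond every index (cell `res-dim4-pi`, K2(p) lane, brick (K12c))

[OURS · counted 0 · cell `res-dim4-pi` · K2(p) lane (holder res-dim4-p-12 g3, naming 23:35:55Z; shape of record =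
res-dim4-p-2 g3's `hK12c` of (K14), bus 00:05:34Z) · seat res-dim4-p-1 g3 · over (K12a) `…ResConeSatellitePair`,
(K12b) `…ResConeSatelliteLight`, K11 (`…ResConeStretchKill` / `…ResConeStretchLedger`, res-dim4-p-2 g3), K13
(`…ResConeContactSupport`, res-dim4-typ-1 g2) and the power-cone package (`…ResConePowerChain`).]  Nothing
here proves K2(p) (the light regime of slice B stays OPEN), `NoIsolatedTrap p p` or resolution of singularities
in dimension ≥ 4 / characteristic `p`.  AI kernel work, weaker than expert review.

THE ASSEMBLY.  On a witnessed isolated above-floor `Step0 p` chain with `x^{r₀} ∣ F₀`, constant shade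
`2 ≤ d < p` and `e_G = 3` from `k₀` on: the power-cone package gives one frame `(ℓ k, a0 k, lam k)`; the
free-tail theorem gives satellite steps `k` beyond every index (K12a `exists_satellite_ge`); at such a step the
letters `j k ≠ j (k+1)` are born and kept up to `k + 2` with `r = (oₖ − p, oₖ₊₁ − p)` (K12a
`stretchBorn_pair_of_satellite`); K13b puts the vertex form on a third letter and K11 (`stretch_no_heavy_pair_of_lt`)
forbids `r (j k) + r (j (k+1)) + 2 ≥ p`.  Hence:

* **`frequently_light_satellite`** (K12c, chain-block form) — `∀ N ∃ k ≥ N`, satellite, with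
  `oₖ + oₖ₊₁ + 3 ≤ 3p` (`oₖ = ord₀ F_k > p`);
* **`lightSatellite_recurrence`** — the same in the BY-VALUE shape `hK12c` consumed by res-dim4-p-2 g3's (K14)
  `…ResConeLightSlices` (whole chain from `k = 0`, orders as `toNat`): «K2(p) ⟺ no light-B trap ∧ no C trap».

At `p = 5` (`o ∈ {6, 7, 8}`): infinitely many satellite steps with `(oₖ, oₖ₊₁) = (6, 6)` — idea-4's A∞/C∞ entry,
THE located residual of slice B after (DL) + FT. [cite: CossartJannsenSaito2020, Thm. 3.10(4), Thm. 3.14]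
[cite: HauserPerlega2019PRIMS, §2]
bears_on: LADDER-RESOLUTION:D157-DOOR2 (res-dim4-pi · K2(p) lane · slice B · K12c).  Supports
stmt-ResolutionOfSingularities-16155 (helper).
-/

set_option linter.dupNamespace false -- mandated namespace of this single-conjunct summit

noncomputable section

namespace Summit.ResolutionOfSingularities.ResolutionOfSingularities.Theorems.PIDim4

namespace ResCone

open MvPolynomial Finset
open Literature.AlgebraicGeometry.Resolution
open Literature.AlgebraicGeometry.Resolution.CentreBlowup
open Literature.AlgebraicGeometry.Resolution.Hauser2010
open Literature.AlgebraicGeometry.Resolution.HauserPerlega2019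

variable {K : Type} [Field K]

/-- **(K12c) LIGHT SATELLITE STEPS RECUR** along a slice-B stretch (witnessed isolated above-floor `Step0 p`
chain, `x^{r₀} ∣ F₀`, constant shade `2 ≤ d < p` and `e_G = 3` from `k₀` on): for every `N` there is a
satellite step `k ≥ N` whose two consecutive orders satisfy `oₖ + oₖ₊₁ + 3 ≤ 3p`.
[cite: CossartJannsenSaito2020, Thm. 3.10(4), Thm. 3.14] [folklore] -/
theorem frequently_light_satellite (p : ℕ) [Fact p.Prime] [CharP K p] [DecidableEq K]
    {c : ℕ → State K} {j : ℕ → Fin 4} {b : ℕ → Fin 4 → K}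
    (hc : ∀ k, IsIsolated p (c k).F ∧ Step0 p (c k) (c (k + 1))) (hw : FreeTail.IsWitnessedChain p c j b)
    (hr0 : ∀ e ∈ (c 0).F.support, (c 0).r ≤ e) (hfloor : ∀ k, ordZero (c k).F ≠ p) {k₀ d : ℕ}
    (hd2 : 2 ≤ d) (hdp : d < p) (hshade : ∀ k, k₀ ≤ k → (c k).shade = (d : ℕ∞))
    (he3 : ∀ k, k₀ ≤ k → Module.finrank K (resVertex (c k)) = 3) (N : ℕ) :
    ∃ k, N ≤ k ∧ FreeTail.IsSatellite j b k ∧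
      ∃ oₖ oₖ₁ : ℕ, ordZero (c k).F = oₖ ∧ ordZero (c (k + 1)).F = oₖ₁ ∧ p < oₖ ∧ p < oₖ₁ ∧
        oₖ + oₖ₁ + 3 ≤ 3 * p := by
  obtain ⟨ℓ, a0, lam, hpkg⟩ := chain_powerCone_package p hc hw hr0 hfloor hdp hshade he3
  have hform : ∀ k, k₀ ≤ k → resForm (c k) = C (a0 k) * (∑ i, C (ℓ k i) * X i) ^ d :=
    fun k hk => (hpkg k hk).2.2.1
  have hdir : ∀ k, k₀ ≤ k → ℓ k (j k) + dotProduct (ℓ k) (b k) = 0 := fun k hk => (hpkg k hk).2.2.2.1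
  have hlam : ∀ k, k₀ ≤ k → lam k ≠ 0 := fun k hk => (hpkg k hk).2.2.2.2.1
  have hprop : ∀ k, k₀ ≤ k → ∀ i, i ≠ j k → ℓ (k + 1) i = lam k * ℓ k i :=
    fun k hk => (hpkg k hk).2.2.2.2.2.1
  have hcarry : ∀ k, k₀ ≤ k → ∃ i, i ≠ j k ∧ ℓ k i ≠ 0 := fun k hk => (hpkg k hk).2.2.2.2.2.2
  obtain ⟨k, hk, hsat⟩ := exists_satellite_ge p hc hw (max N k₀)
  obtain ⟨oₖ, oₖ₁, hoₖ, hoₖ₁, hpoₖ, hpoₖ₁, -, ha, hb, hkept₁, hkept₂⟩ :=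
    stretchBorn_pair_of_satellite p hc hw hfloor hsat
  refine ⟨k, (le_max_left _ _).trans hk, hsat, oₖ, oₖ₁, hoₖ, hoₖ₁, hpoₖ, hpoₖ₁, ?_⟩
  by_contra hlt
  refine stretch_no_heavy_pair_of_lt p hc hw hr0 hfloor hd2 hdp hshade hform hdir hlam hprop hcarry
    (k₁ := k) (k₂ := k + 1) (k := k + 2) ((le_max_right _ _).trans hk) (Nat.lt_succ_self k) (by omega)
    hsat.1.symm hkept₁ hkept₂ ?_
  rw [ha, hb]
  omega

/-- **K12c in the by-value shape of (K14)** (res-dim4-p-2 g3's `hK12c`): for every witnessed `Step0 p` chain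
with `x^{r₀} ∣ F₀` all of whose states are isolated, above the floor, of shade `d` (`2 ≤ d < p`) and `e_G = 3`,
satellite steps with `ord₀ F_k + ord₀ F_{k+1} + 3 ≤ 3p` occur beyond every index.
[cite: CossartJannsenSaito2020, Thm. 3.10(4), Thm. 3.14] [folklore] -/
theorem lightSatellite_recurrence (p : ℕ) [Fact p.Prime] :
    ∀ (K : Type) [Field K] [CharP K p] [DecidableEq K] (c : ℕ → State K) (d : ℕ) (j : ℕ → Fin 4)
      (b : ℕ → Fin 4 → K), 2 ≤ d → d < p → (∀ e' ∈ (c 0).F.support, (c 0).r ≤ e') →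
      FreeTail.IsWitnessedChain p c j b →
      (∀ k, IsIsolated p (c k).F ∧ Step0 p (c k) (c (k + 1)) ∧ ordZero (c k).F ≠ p ∧
        (c k).shade = (d : ℕ∞) ∧ Module.finrank K (resVertex (c k)) = 3) →
      ∀ N, ∃ k, N ≤ k ∧ FreeTail.IsSatellite j b k ∧
        (ordZero (c k).F).toNat + (ordZero (c (k + 1)).F).toNat + 3 ≤ 3 * p := by
  intro K _ _ _ c d j b hd2 hdp hr0 hw hall N
  obtain ⟨k, hk, hsat, oₖ, oₖ₁, hoₖ, hoₖ₁, -, -, hle⟩ :=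
    frequently_light_satellite p (fun k => ⟨(hall k).1, (hall k).2.1⟩) hw hr0 (fun k => (hall k).2.2.1)
      (k₀ := 0) hd2 hdp (fun k _ => (hall k).2.2.2.1) (fun k _ => (hall k).2.2.2.2) N
  refine ⟨k, hk, hsat, ?_⟩
  rw [hoₖ, hoₖ₁, ENat.toNat_coe, ENat.toNat_coe]
  exact hle

end ResCone

end Summit.ResolutionOfSingularities.ResolutionOfSingularities.Theorems.PIDim4

end
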